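import Summits.BirchSwinnertonDyer.BirchSwinnertonDyer.Theorems.ResidualThetaTransportAtTwoSignedCompactTowerMittagLeffler
import Literature.NumberTheory.EllipticCurves.LambdaAdicSelmerDataTorsionPowReduce
import Literature.NumberTheory.EllipticCurves.Kato2004.IwasawaTwistTateToTateH1Proofs
import Literature.NumberTheory.GaloisRepresentations.ContinuousCorestrictionComp
import HarnessLib

/-!
# The `Λ`-adic road to SURJ⁺@2 (item 23110), Mittag-Leffler package — TURNKEY FORM: the EXPLICIT transition maps
# `Cor_{ℚ_j/ℚ_{n₀}} ∘ (p^{j−k₀})_* : H¹(ℚ_j, E[p^j]) → H¹(ℚ_{n₀}, E[p^{k₀}])` form a transition system, so for `j ≫ 0` they kill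
# every class whose image over `ℚ_∞` is `+`-Selmer

Routes `ResidualThetaTransportAtTwo` (RTT, crux r201 `ResidualLambdaFormulaNegDiscAtTwo`, stmt-BirchSwinnertonDyer-23110) /
`ThetaPartnerAtTwo` (K1 `stub_surj2`). Seat `prover-bsd-wall-tp2-p2x-w2` g14; `--supports stmt-BirchSwinnertonDyer-23110`.
THEOREMS ONLY (no definition, no named fact, no `sorry`); closes nothing.

WHY. `exists_transition_eq_zero_comap_toInfty` / `…_signedSelmerInfty_of_goodSS` (p655974, this seat) conclude «some `T j j` is zero»
for an ABSTRACT transition system `T` (`T n₀ k₀ = id`, `T n (k+1) = T n k ∘ p_*`, `T (n+1) k = T n k ∘ Cor` on the quadrant). The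
layer Poitou–Tate step pairs local classes against `Cor ∘ (p^{j−k₀})_*` of Selmer classes (the adjoints of `res` and of
`E[p^{k₀}] ↪ E[p^j]` under the local Tate pairings), so THIS FILE realises `T` by these maps and discharges the three equations:

* `geomTorsionPowReduce_subgroupRep` — equivariance of `(p^{a−b}) • : E[p^a] → E[p^b]` (tree `WeierstrassCurve.geomTorsionPowReduce`)
  on the restricted representations, the hypothesis shape of `Kato2004.mapH1AddHom`;
* `powReduceH1_self`, `powReduceH1_succ`, `powReduceH1_layerCores` — `(p^0)_* = id`, `(p^{a+1−b})_* = (p^{a−b})_* ∘ p_*`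
  (`WeierstrassCurve.reduceTorsionH1`), and `(p^{a−b})_*` commutes with the trace maps `Kato2004.layerCores` (`mapH1AddHom_coresLe`);
* `exists_coresLe_powReduce_eq_zero_comap_toInfty` — for `κ` cyclotomic with topological generator `γ`, `E(ℚ_∞)[p^∞] = 0`,
  `p`-torsion-free layers `H¹(ℚ_n, T_pE)`, and a `conj_γ`-stable `A ≤ H¹(ℚ_∞, E[p^∞])` with `A[p]` finite: for every `(n₀, k₀)` there are
  `j ≥ n₀, k₀` such that `Cor_{ℚ_j/ℚ_{n₀}} ((p^{j−k₀})_* x) = 0` for EVERY `x ∈ H¹(ℚ_j, E[p^j])` with `θ_{j,j} x ∈ A` (for any finiteness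
  structure on `Gal(ℚ_j/ℚ_{n₀})`, the instance being a subsingleton) — the package run with
  `T n k = Cor_{ℚ_n/ℚ_{n₀}} ∘ (p^{k−k₀})_*` (`coresLe_refl_apply`, `coresLe_comp`, the three lemmas above);
* `exists_coresLe_powReduce_eq_zero_signedSelmerInfty_of_goodSS` — `p = 2`, `E` globally minimal with good supersingular reduction at
  `2`, `A = Sel⁺(E/ℚ_∞)` of a finitely generated torsion `+` dual datum with `μ = 0`, EVERY rank: for `j ≫ 0`,
  `Cor_{ℚ_j/ℚ_{n₀}} ∘ (2^{j−k₀})_*` kills every class of `H¹(ℚ_j, E[2^j])` whose image over `ℚ_∞` is `+`-Selmer.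

HONEST FRAMING: closes nothing; the Poitou–Tate step (orthogonality ⟹ lift, with the descended `+` condition and its self-duality at
`2`) is NOT done; 23110 is NOT proved; BSD is not proved by any of this.
References: [NeukirchSchmidtWingberg2008] I §5, Prop. 1.5.3 (iii) (transitivity of `cor`), (1.5.6)–(1.5.7); [PerrinRiou1987BSMF] §0
(the transition maps `p_*`); [Rubin2000] App. B §B.3; [GreenbergVatsal2000] §2 Prop. (2.1).
-/

set_option autoImplicit false
-- D-0017: single-problem summit, so `Summit.BirchSwinnertonDyer.BirchSwinnertonDyer.…` repeats a namespace BY DESIGN.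
set_option linter.dupNamespace false

noncomputable section

open scoped AddSubgroup
open Field CategoryTheory
open Literature.NumberTheory.GaloisRepresentations
open Literature.NumberTheory.EllipticCurves Literature.NumberTheory.EllipticCurves.Kato2004
open Literature.NumberTheory.EllipticCurves.Kato2004.EulerSystemValues
open Literature.NumberTheory.EllipticCurves.AcSigned (toInfty)
open WeierstrassCurve (geomTorsion geomPoints)

namespace Summit.BirchSwinnertonDyer.BirchSwinnertonDyer.Theorems.ResidualThetaLayer.TowerVanishing

variable {p : ℕ} [Fact p.Prime] (W : WeierstrassCurve ℚ) (κ : ZpExtension ℚ p)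

/-! ## §1 The coefficient maps `(p^{a−b})_* : H¹(U, E[p^a]) → H¹(U, E[p^b])` -/

omit [Fact p.Prime] in
/-- Equivariance of `(p^{a−b}) • : E[p^a] → E[p^b]` on the restricted representations `E[p^·]|_U` (the hypothesis shape of
`mapH1AddHom`). [cite: PerrinRiou1987BSMF, §0 p. 401] -/
theorem geomTorsionPowReduce_subgroupRep (a b : ℕ) (h : b ≤ a) (U : Subgroup (absoluteGaloisGroup ℚ)) (u : U)
    (P : geomTorsion W ((p : ℤ) ^ a)) :
    W.geomTorsionPowReduce p a b h ((subgroupRep (W.torsionGaloisModule ((p : ℤ) ^ a)).toTopRep U).ρ u P) =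
      (subgroupRep (W.torsionGaloisModule ((p : ℤ) ^ b)).toTopRep U).ρ u (W.geomTorsionPowReduce p a b h P) := by
  apply Subtype.ext
  change ((W.geomTorsionPowReduce p a b h ((u : absoluteGaloisGroup ℚ) • P) : geomTorsion W ((p : ℤ) ^ b)) :
      geomPoints W) =
    (((u : absoluteGaloisGroup ℚ) • W.geomTorsionPowReduce p a b h P : geomTorsion W ((p : ℤ) ^ b)) : geomPoints W)
  rw [WeierstrassCurve.coe_geomTorsionPowReduce, AddSubgroup.torsionBy.coe_smul, AddSubgroup.torsionBy.coe_smul,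
    WeierstrassCurve.coe_geomTorsionPowReduce]
  exact (map_zsmul (DistribSMul.toAddMonoidHom (geomPoints W) (u : absoluteGaloisGroup ℚ)) ((p : ℤ) ^ (a - b))
    (P : geomPoints W)).symm

omit [Fact p.Prime] in
/-- `(p^{a−a})_* = id` on `H¹(U, E[p^a])`. [cite: PerrinRiou1987BSMF, §0 p. 401] -/
theorem powReduceH1_self (a : ℕ) (U : Subgroup (absoluteGaloisGroup ℚ)) (x : W.torsionH1Over ((p : ℤ) ^ a) U) :
    mapH1AddHom (subgroupRep (W.torsionGaloisModule ((p : ℤ) ^ a)).toTopRep U)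
      (subgroupRep (W.torsionGaloisModule ((p : ℤ) ^ a)).toTopRep U) (W.geomTorsionPowReduce p a a le_rfl)
      continuous_of_discreteTopology (geomTorsionPowReduce_subgroupRep W a a le_rfl U) x = x := by
  obtain ⟨φ, rfl⟩ := oneCocycleClass_surjective (subgroupRep (W.torsionGaloisModule ((p : ℤ) ^ a)).toTopRep U) x
  rw [mapH1AddHom_oneCocycleClass]
  congr 1
  refine Subtype.ext (ContinuousMap.ext fun g ↦ ?_)
  rw [contOneCocycles.pushAddHom_apply]
  apply Subtype.ext
  rw [WeierstrassCurve.coe_geomTorsionPowReduce, Nat.sub_self, pow_zero, one_smul]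

omit [Fact p.Prime] in
/-- `(p^{a+1−b})_* = (p^{a−b})_* ∘ p_*` on `H¹(U, E[p^{a+1}])` (`p_* = WeierstrassCurve.reduceTorsionH1`).
[cite: PerrinRiou1987BSMF, §0 p. 401] -/
theorem powReduceH1_succ (a b : ℕ) (h : b ≤ a) (U : Subgroup (absoluteGaloisGroup ℚ))
    (x : W.torsionH1Over ((p : ℤ) ^ (a + 1)) U) :
    mapH1AddHom (subgroupRep (W.torsionGaloisModule ((p : ℤ) ^ (a + 1))).toTopRep U)
      (subgroupRep (W.torsionGaloisModule ((p : ℤ) ^ b)).toTopRep U) (W.geomTorsionPowReduce p (a + 1) b (h.trans (Nat.le_succ a)))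
      continuous_of_discreteTopology (geomTorsionPowReduce_subgroupRep W (a + 1) b (h.trans (Nat.le_succ a)) U) x =
    mapH1AddHom (subgroupRep (W.torsionGaloisModule ((p : ℤ) ^ a)).toTopRep U)
      (subgroupRep (W.torsionGaloisModule ((p : ℤ) ^ b)).toTopRep U) (W.geomTorsionPowReduce p a b h)
      continuous_of_discreteTopology (geomTorsionPowReduce_subgroupRep W a b h U) (W.reduceTorsionH1 p a U x) := by
  obtain ⟨φ, rfl⟩ :=
    oneCocycleClass_surjective (subgroupRep (W.torsionGaloisModule ((p : ℤ) ^ (a + 1))).toTopRep U) x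
  rw [reduceTorsionH1_oneCocycleClass, mapH1AddHom_oneCocycleClass, mapH1AddHom_oneCocycleClass]
  congr 1
  refine Subtype.ext (ContinuousMap.ext fun g ↦ ?_)
  rw [contOneCocycles.pushAddHom_apply, contOneCocycles.pushAddHom_apply, contOneCocycles.pushAddHom_apply]
  apply Subtype.ext
  rw [WeierstrassCurve.coe_geomTorsionPowReduce, WeierstrassCurve.coe_geomTorsionPowReduce,
    WeierstrassCurve.coe_geomTorsionReduce, smul_smul, ← pow_succ, Nat.sub_add_comm h]

/-- `(p^{a−b})_*` commutes with the trace maps of the tower (`Cor` is a morphism of cohomological functors, `mapH1AddHom_coresLe`).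
[cite: NeukirchSchmidtWingberg2008, I §5] -/
theorem powReduceH1_layerCores (n a b : ℕ) (h : b ≤ a)
    (x : W.torsionH1Over ((p : ℤ) ^ a) (κ.layerSubgroup (n + 1))) :
    mapH1AddHom (subgroupRep (W.torsionGaloisModule ((p : ℤ) ^ a)).toTopRep (κ.layerSubgroup n))
        (subgroupRep (W.torsionGaloisModule ((p : ℤ) ^ b)).toTopRep (κ.layerSubgroup n)) (W.geomTorsionPowReduce p a b h)
        continuous_of_discreteTopology (geomTorsionPowReduce_subgroupRep W a b h (κ.layerSubgroup n))
        (layerCores (W.torsionGaloisModule ((p : ℤ) ^ a)) κ n x) =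
      layerCores (W.torsionGaloisModule ((p : ℤ) ^ b)) κ n
        (mapH1AddHom (subgroupRep (W.torsionGaloisModule ((p : ℤ) ^ a)).toTopRep (κ.layerSubgroup (n + 1)))
          (subgroupRep (W.torsionGaloisModule ((p : ℤ) ^ b)).toTopRep (κ.layerSubgroup (n + 1))) (W.geomTorsionPowReduce p a b h)
          continuous_of_discreteTopology (geomTorsionPowReduce_subgroupRep W a b h (κ.layerSubgroup (n + 1))) x) := by
  unfold layerCores
  exact mapH1AddHom_coresLe (X := (W.torsionGaloisModule ((p : ℤ) ^ a)).toTopRep)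
    (Y := (W.torsionGaloisModule ((p : ℤ) ^ b)).toTopRep) (H := κ.layerSubgroup (n + 1))
    (H' := κ.layerSubgroup n) (hF := _) (W.geomTorsionPowReduce p a b h) continuous_of_discreteTopology
    (κ.layerSubgroup_antitone (Nat.le_succ n)) (κ.isOpen_layerSubgroup (n + 1))
    (geomTorsionPowReduce_subgroupRep W a b h _) (geomTorsionPowReduce_subgroupRep W a b h _) x

/-! ## §2 The explicit transition system `Cor_{ℚ_n/ℚ_{n₀}} ∘ (p^{k−k₀})_*` and the turnkey Mittag-Leffler statements -/

variable {γ : absoluteGaloisGroup ℚ}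

/-- **Mittag-Leffler vanishing with the EXPLICIT transitions `Cor ∘ (p^{j−k₀})_*`.** Let `κ` be the cyclotomic `ℤ_p`-extension of
`ℚ` with topological generator `γ`, assume `E(ℚ_∞)[p^∞] = 0` and that the layers `H¹(ℚ_n, T_pE)` have no `p`-torsion, and let
`A ≤ H¹(ℚ_∞, E[p^∞])` be `conj_γ`-stable with `A[p]` finite. Then for every `(n₀, k₀)` there are `j ≥ n₀, k₀` such that
`Cor_{ℚ_j/ℚ_{n₀}} ((p^{j−k₀})_* x) = 0` for every `x ∈ H¹(ℚ_j, E[p^j])` whose image `θ_{j,j} x` over `ℚ_∞` lies in `A` (for any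
chosen finiteness structures `hF` on the layer quotients `Gal(ℚ_m/ℚ_n)`, e.g. `fun n m ↦ Fintype.ofFinite _`). This is
`exists_transition_eq_zero_comap_toInfty` run with `T n k = Cor_{ℚ_n/ℚ_{n₀}} ∘ (p^{k−k₀})_*`, whose three equations are
`coresLe_refl_apply` + `powReduceH1_self`, `powReduceH1_succ`, and `powReduceH1_layerCores` + transitivity `coresLe_comp`.
[cite: NeukirchSchmidtWingberg2008, Prop. 1.5.3 (iii) and (1.5.6)–(1.5.7)] [cite: GreenbergVatsal2000, §2 Prop. (2.1)]
[cite: Rubin2000, App. B §B.3] -/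
theorem exists_coresLe_powReduce_eq_zero_comap_toInfty [W.IsElliptic] [ContinuousSMul ℤ_[p] (W.tateModule p)]
    [hF : ∀ n m : ℕ, Fintype (κ.layerSubgroup n ⧸ (κ.layerSubgroup m).subgroupOf (κ.layerSubgroup n))]
    (hκ : κ.IsCyclotomic) (hγ : κ.IsTopGenerator γ)
    (hfix : ∀ c : W.geomPrimaryTorsion p, (∀ σ ∈ κ.kerSubgroup, σ • c = c) → c = 0)
    (htf : ∀ (n k : ℕ) (y : H1 (tateRep W p) (κ.layerSubgroup n)), ((p : ℤ_[p]) ^ k) • y = 0 → y = 0)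
    (A : AddSubgroup (W.subgroupH1 p κ.kerSubgroup)) (hAγ : ∀ s ∈ A, W.conjH1 p κ.kerSubgroup γ s ∈ A)
    [Finite ((↥A)[(p : ℤ)])] (n₀ k₀ : ℕ) :
    ∃ (j : ℕ) (hn : n₀ ≤ j) (hk : k₀ ≤ j),
      ∀ x : W.torsionH1Over ((p : ℤ) ^ j) (κ.layerSubgroup j), toInfty W p κ j j x ∈ A →
        coresLe (W.torsionGaloisModule ((p : ℤ) ^ k₀)).toTopRep (κ.layerSubgroup_antitone hn) (κ.isOpen_layerSubgroup j)
          (mapH1AddHom (subgroupRep (W.torsionGaloisModule ((p : ℤ) ^ j)).toTopRep (κ.layerSubgroup j))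
            (subgroupRep (W.torsionGaloisModule ((p : ℤ) ^ k₀)).toTopRep (κ.layerSubgroup j))
            (W.geomTorsionPowReduce p j k₀ hk) continuous_of_discreteTopology
            (geomTorsionPowReduce_subgroupRep W j k₀ hk (κ.layerSubgroup j)) x) = 0 := by
  classical
  -- the coefficient maps `(p^{k−k₀})_*` and the corestrictions to `ℚ_{n₀}`
  let PR : ∀ (n k : ℕ), k₀ ≤ k → W.torsionH1Over ((p : ℤ) ^ k) (κ.layerSubgroup n) →
      W.torsionH1Over ((p : ℤ) ^ k₀) (κ.layerSubgroup n) := fun n k hk x ↦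
    mapH1AddHom (subgroupRep (W.torsionGaloisModule ((p : ℤ) ^ k)).toTopRep (κ.layerSubgroup n))
      (subgroupRep (W.torsionGaloisModule ((p : ℤ) ^ k₀)).toTopRep (κ.layerSubgroup n))
      (W.geomTorsionPowReduce p k k₀ hk) continuous_of_discreteTopology
      (geomTorsionPowReduce_subgroupRep W k k₀ hk (κ.layerSubgroup n)) x
  let CO : ∀ n : ℕ, n₀ ≤ n → W.torsionH1Over ((p : ℤ) ^ k₀) (κ.layerSubgroup n) →
      W.torsionH1Over ((p : ℤ) ^ k₀) (κ.layerSubgroup n₀) := fun n hn y ↦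
    coresLe (W.torsionGaloisModule ((p : ℤ) ^ k₀)).toTopRep (κ.layerSubgroup_antitone hn) (κ.isOpen_layerSubgroup n) y
  let T : ∀ n k : ℕ, W.torsionH1Over ((p : ℤ) ^ k) (κ.layerSubgroup n) →
      W.torsionH1Over ((p : ℤ) ^ k₀) (κ.layerSubgroup n₀) := fun n k x ↦
    if h : n₀ ≤ n ∧ k₀ ≤ k then CO n h.1 (PR n k h.2 x) else 0
  have hT : ∀ (n k : ℕ) (h : n₀ ≤ n ∧ k₀ ≤ k) (x : W.torsionH1Over ((p : ℤ) ^ k) (κ.layerSubgroup n)),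
      T n k x = CO n h.1 (PR n k h.2 x) := fun n k h x ↦ dif_pos h
  -- `layerCores` is `coresLe` (any finiteness structure)
  have hlc : ∀ (n : ℕ) (y : W.torsionH1Over ((p : ℤ) ^ k₀) (κ.layerSubgroup (n + 1))),
      layerCores (W.torsionGaloisModule ((p : ℤ) ^ k₀)) κ n y =
        coresLe (W.torsionGaloisModule ((p : ℤ) ^ k₀)).toTopRep (κ.layerSubgroup_antitone (Nat.le_succ n))
          (κ.isOpen_layerSubgroup (n + 1)) y := fun n y ↦ by
    unfold layerCores
    convert rfl
    all_goals rfl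
  -- the three equations
  have hT0 : ∀ x, T n₀ k₀ x = x := fun x ↦ by
    rw [hT n₀ k₀ ⟨le_rfl, le_rfl⟩]
    exact (congrArg (CO n₀ le_rfl) (powReduceH1_self W k₀ _ x)).trans (coresLe_refl_apply _ _ _ _)
  have hTk : ∀ (n k : ℕ) (x : W.torsionH1Over ((p : ℤ) ^ (k + 1)) (κ.layerSubgroup n)), n₀ ≤ n → k₀ ≤ k →
      T n (k + 1) x = T n k (W.reduceTorsionH1 p k (κ.layerSubgroup n) x) := fun n k x hn hk ↦ by
    rw [hT n (k + 1) ⟨hn, hk.trans (Nat.le_succ k)⟩, hT n k ⟨hn, hk⟩]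
    exact congrArg (CO n hn) (powReduceH1_succ W k k₀ hk _ x)
  have hTn : ∀ (n k : ℕ) (x : W.torsionH1Over ((p : ℤ) ^ k) (κ.layerSubgroup (n + 1))), n₀ ≤ n → k₀ ≤ k →
      T (n + 1) k x = T n k (layerCores (W.torsionGaloisModule ((p : ℤ) ^ k)) κ n x) := fun n k x hn hk ↦ by
    rw [hT (n + 1) k ⟨hn.trans (Nat.le_succ n), hk⟩, hT n k ⟨hn, hk⟩]
    have h1 : PR n k hk (layerCores (W.torsionGaloisModule ((p : ℤ) ^ k)) κ n x) =
        layerCores (W.torsionGaloisModule ((p : ℤ) ^ k₀)) κ n (PR (n + 1) k hk x) :=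
      powReduceH1_layerCores W κ n k k₀ hk x
    have h2 : CO n hn (layerCores (W.torsionGaloisModule ((p : ℤ) ^ k₀)) κ n (PR (n + 1) k hk x)) =
        CO (n + 1) (hn.trans (Nat.le_succ n)) (PR (n + 1) k hk x) := by
      rw [hlc]
      exact LinearMap.congr_fun (coresLe_comp (X := (W.torsionGaloisModule ((p : ℤ) ^ k₀)).toTopRep)
        (κ.layerSubgroup_antitone (Nat.le_succ n)) (κ.layerSubgroup_antitone hn)
        (κ.isOpen_layerSubgroup (n + 1)) (κ.isOpen_layerSubgroup n)) (PR (n + 1) k hk x)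
    rw [h1, h2]
  obtain ⟨j, hj₁, hj₂, hj⟩ :=
    exists_transition_eq_zero_comap_toInfty W κ hκ hγ hfix htf A hAγ n₀ k₀ T hT0 hTk hTn
  refine ⟨j, hj₁, hj₂, fun x hx ↦ ?_⟩
  have h0 := hj x hx
  rw [hT j j ⟨hj₁, hj₂⟩] at h0
  exact h0

/-- **Turnkey Mittag-Leffler vanishing for Kobayashi's `+` Selmer tower at `p = 2`, every rank, explicit transitions.** For `E/ℚ`
globally minimal with good supersingular reduction at `2`, `κ` the cyclotomic `ℤ₂`-extension with topological generator `γ`, and a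
`+` signed Selmer dual datum `D` with `X⁺` finitely generated torsion and `μ = 0`: for every `(n₀, k₀)` there are `j ≥ n₀, k₀` such
that `Cor_{ℚ_j/ℚ_{n₀}} ((2^{j−k₀})_* x) = 0` for EVERY class `x ∈ H¹(ℚ_j, E[2^j])` whose image over `ℚ_∞` lies in `Sel⁺(E/ℚ_∞)`
(`signedSelmerInfty E κ 1`); `hF` = any finiteness structures on the layer quotients. The Poitou–Tate consumer pairs its local
classes against exactly these transitions (adjoints of `res` and of `E[2^{k₀}] ↪ E[2^j]` under local Tate duality); no
`Finite Sel(E/ℚ)`, no weak Leopoldt, no print fact is used.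
[cite: GreenbergVatsal2000, §2 Prop. (2.1)] [cite: Kobayashi2003, Def. 1.1] [cite: NeukirchSchmidtWingberg2008, Prop. 1.5.3 (iii)] -/
theorem exists_coresLe_powReduce_eq_zero_signedSelmerInfty_of_goodSS {E : WeierstrassCurve ℚ} [E.IsElliptic]
    [E.IsGloballyMinimal] [ContinuousSMul ℤ_[2] (E.tateModule 2)] (hss : Rank1Residual.GoodSS E 2)
    {κ : ZpExtension ℚ 2} {γ : absoluteGaloisGroup ℚ}
    [hF : ∀ n m : ℕ, Fintype (κ.layerSubgroup n ⧸ (κ.layerSubgroup m).subgroupOf (κ.layerSubgroup n))]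
    (hκ : κ.IsCyclotomic) (hγ : κ.IsTopGenerator γ)
    (D : Kobayashi2003.SignedSelmerDualData E κ γ 1) [Module.Finite (IwasawaAlgebra 2) D.X]
    (hT : Module.IsTorsion (IwasawaAlgebra 2) D.X) (hμ : D.mu = 0) (n₀ k₀ : ℕ) :
    ∃ (j : ℕ) (hn : n₀ ≤ j) (hk : k₀ ≤ j),
      ∀ x : E.torsionH1Over ((2 : ℤ) ^ j) (κ.layerSubgroup j),
        toInfty E 2 κ j j x ∈ Kobayashi2003.signedSelmerInfty E κ 1 →
        coresLe (E.torsionGaloisModule ((2 : ℤ) ^ k₀)).toTopRep (κ.layerSubgroup_antitone hn) (κ.isOpen_layerSubgroup j)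
          (mapH1AddHom (subgroupRep (E.torsionGaloisModule ((2 : ℤ) ^ j)).toTopRep (κ.layerSubgroup j))
            (subgroupRep (E.torsionGaloisModule ((2 : ℤ) ^ k₀)).toTopRep (κ.layerSubgroup j))
            (E.geomTorsionPowReduce 2 j k₀ hk) continuous_of_discreteTopology
            (geomTorsionPowReduce_subgroupRep E j k₀ hk (κ.layerSubgroup j)) x) = 0 := by
  haveI := SignedTransportAtTwo.finite_torsionBy_signedSelmerInfty E κ γ 1 D hT hμ
  have hbot := SignedTransportAtTwo.fixedPoints_kerSubgroup_eq_bot_of_goodSS E hss κ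
  have hfix : ∀ c : E.geomPrimaryTorsion 2, (∀ σ ∈ κ.kerSubgroup, σ • c = c) → c = 0 := fun c hc ↦ by
    have hmem : c ∈ FixedPoints.addSubgroup κ.kerSubgroup (↥(E.geomPrimaryTorsion 2)) := by
      rw [FixedPoints.mem_addSubgroup]
      intro τ
      rw [Subgroup.mk_smul]
      exact hc τ τ.2
    rw [hbot, AddSubgroup.mem_bot] at hmem
    exact hmem
  exact exists_coresLe_powReduce_eq_zero_comap_toInfty E κ hκ hγ hfix
    (fun n k y hy ↦ layerH1_eq_zero_of_pow_smul_eq_zero_of_goodSS hss κ n k y hy)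
    (Kobayashi2003.signedSelmerInfty E κ 1) (fun s hs ↦ Kobayashi2003.conjH1_mem_signedSelmerInfty E κ 1 γ hs) n₀ k₀

end Summit.BirchSwinnertonDyer.BirchSwinnertonDyer.Theorems.ResidualThetaLayer.TowerVanishing

end
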